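import Summits.Ventures.HSemireg.UntwistAssembly
import Summits.Ventures.HSemireg.HomComplexSigma
import HarnessLib

/-!
# Venture HSemireg — route R1.0 for a STRICTLY PERFECT complex `E₀` with the tree's REAL `σ_q` for complexes
# (`HomComplex.sigmaC`, `HomComplex.IsISemiregularC`) on the source side

HONEST FRAMING. The th-4 files `UntwistDerivedTheta` / `UntwistDerivedAdjunction` / `UntwistAssembly` state the untwisting
kernel clause for a complex `E₀` on `X₀/S` with ABSTRACT component families `σ_q` on `Hom_{D(X₀)}(Q E₀, (Q E₀)⟦2⟧)`
(«no `σ` for complexes in the tree»). Meanwhile the cell's K2 chain (seats p3 / t-7 / gs-g4, `HomComplexSigma.lean`) has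
CONSTRUCTED `σ_q` for a STRICTLY PERFECT complex on real carriers: for `K•` concentrated in `[a, b]` with every `K^p`
finite locally free, `HomComplex.sigmaC X K a b hK q : Hom_D(Q K•, (Q K•)⟦2⟧) → Hom_D(Q 𝒪_X[0], (Q Ω^q_X[0])⟦q+2⟧)`
(additive: `sigmaCHom`) and the predicate `HomComplex.IsISemiregularC X K a b hK I` (joint injectivity of
`(σ_q)_{q ∈ I}`; joint-kernel form `isISemiregularC_iff_ker`). This file PLUGS that real source family into the
th-4 chain: the SOURCE side of R1.0 (the object `E₀` on `X₀`, whose FULL semiregularity the engines certify) is now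
the tree's own `IsISemiregularC`, while the TARGET side (the gerbe object `E₀′ = π^*E₀ ⊗ L^{∓1}`; no gerbe carrier in
the tree) stays an abstract additive family `σ′_q` on `Hom(ΨE₀, (ΨE₀)⟦2⟧)`. No functor, gerbe or variety is
constructed; no definition, no named fact; every geometric input is a binder; nothing here says HC, HC_CM or HC_AV
is proved. Numbers by value only: `E₀ = Φ(I_p ⊠ I_q)` two-term of amplitude `[-1, 0]`, `Hom_{D(X₀)}(E₀, E₀⟦2⟧)` of
dimension `18`, targets `⊕_q H^{q+2}(X₀, Ω^q)` of dimension `28`.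

What is proved (names in `Summit.Ventures.HSemireg`):
* `isISemiregularC_iff_jointlyInjective_of_bijective_commShift` — MINIMAL categorical input (object-wise bijectivity of
  `θ x = Ψ x ≫ (Ψ.commShiftIso 2)_{E₀}`, red-4 R4-20(vi)), triangular re-expansion with arbitrary `u`, lower set `I`:
  `IsISemiregularC X₀ E₀ a b hK I ↔ (σ′_q)_{q ∈ I}` jointly injective;
* `jointlyInjective_of_isISemiregularC_univ_of_exactAdjunction_equivalence` — the direction the route consumes, FULL
  map, with `θ` REAL from SHEAF-LEVEL data (`F ⊣ Rf` exact adjoint pair with `F` full faithful = `π^* ⊣ π_*` tame,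
  unit `E ⥲ π_*π^*E` an iso; `Φe` an additive equivalence = `- ⊗ L^{∓1}`; `UntwistDerivedAdjunction`), arbitrary `u`;
* `isISemiregularC_iff_jointlyInjective_of_bijective_commShift_of_leibniz` and
  `jointlyInjective_of_isISemiregularC_univ_of_exactAdjunction_equivalence_of_leibniz` — the same two with the
  mixing maps produced by the LEIBNIZ RULE `a′ = θ_R a + c` in Buchweitz–Flenner's algebra (`UntwistSigmaMultiplier`:
  `Commute (θ_R a) c`, trace compatibilities `hd`, `hμ`; the real `σ_q = sigmaC` realised as `τ_q(ι x · a^q)` — a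
  binder: the ring `A_{E₀}` is not a real carrier).
* §4 `isISemiregularC_iff_isISemiregularC_of_triangular` / `…_of_leibniz` — the UNTWISTED READING with BOTH sides the
  tree's real predicate: two strictly perfect complexes `E₀`, `E₀′` on the SAME `X₀` (intended `E₀′ = E₀ ⊗ M_B`), `θ` any
  additive bijection `Hom(Q E₀, (Q E₀)⟦2⟧) ≃ Hom(Q E₀′, (Q E₀′)⟦2⟧)` (intended: induced by `D(- ⊗ M_B)`), triangular /
  Leibniz re-expansion with injective diagonal ⟹ `IsISemiregularC X₀ E₀ a b hK I ↔ IsISemiregularC X₀ E₀′ a′ b′ hK′ I`.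
So the assembled sentence of `UntwistAssembly` §3 now starts from the tree's own predicate: «`F ⊣ Rf` exact adjoint pair
with `F` f.f. ∧ `Φe` equivalence ∧ Leibniz data ∧ `d_q` injective ⟹ (`IsISemiregularC X₀ E₀ a b hK univ` ⟹ all `σ′_q`
jointly injective)», and in the untwisted reading it is an `iff` between two instances of the tree's predicate.
NOT here (unchanged): the functors `π^*`, `π_*`, `- ⊗ L^{∓1}`, the gerbe, `σ′_q` for the gerbe object on real carriers,
the ring `A_{E₀}` and the Leibniz rule on real carriers, the Mod-vs-QCoh reading, tameness (a binder).
NORMALISATION (ref-2 g12 (S1)): `HomComplex.sigmaC` omits Buchweitz–Flenner's scalar `(-1)^q/q!` (Def. 4.1); its kernels —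
hence `IsISemiregularC` — agree with those of BF's `σ_q` exactly when `q!` is a unit on the targets (true over `ℚ`-algebras
such as `ℂ` or a CM field; NOT over an arbitrary base `S` in characteristic `≤ q`); every statement below is about the tree's
`IsISemiregularC` as defined. FRAME (red-2 R216): [Lieblich2007] Lemma 2.1.1.12 as printed gives the COUNIT
`π^*π_*𝓕 ⥲ 𝓕` for inertia-trivial (weight-`0`) sheaves `𝓕` on a gerbe; the binder «`F` full and faithful» below is the
UNIT `E ⥲ π_*π^*E` (true for a gerbe: `π^*E` has trivial inertia action and `π` has sections locally) — both are frame
only, nothing of either is consumed.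

## References

* [BuchweitzFlenner2003] R.-O. Buchweitz, H. Flenner, Compositio Math. 137 (2003): Def. 4.1, §4.1, §5 (`I`-semiregular).
* [Atiyah1957] M. F. Atiyah, Trans. Amer. Math. Soc. 85 (1957), Prop. 10–12 (pp. 195–196).
* [HuybrechtsLehn1997] D. Huybrechts, M. Lehn, *The geometry of moduli spaces of sheaves*, §10.1.5 (Leibniz rule).
* [GortzWedhorn2023] U. Görtz, T. Wedhorn, *Algebraic Geometry II*, Prop. F.191 (derived adjunction of exact functors).
* [Lieblich2007] M. Lieblich, *Moduli of twisted sheaves*, Duke Math. J. 138 (2007), arXiv Lemma 2.1.1.12 (counit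
  `π^*π_*𝓕 ⥲ 𝓕` on inertia-trivial sheaves; frame for the unit binder «`F` full and faithful»).
-/

namespace Summit.Ventures.HSemireg

open CategoryTheory CategoryTheory.Limits AlgebraicGeometry Finset
open Literature.AlgebraicGeometry.Modules Literature.AlgebraicGeometry.Motives

/-! ### 1. Kernel clause with the real source family `σ_q = HomComplex.sigmaC`, minimal categorical input -/

section RealSourceMinimal

universe w v' u u'

variable {S : Type u} [CommRing S] {X₀ : Over (Spec (CommRingCat.of S))} [HasDerivedCategory.{w} X₀.left.Modules]
  (E₀ : CochainComplex X₀.left.Modules ℤ) (a b : ℤ) [E₀.IsStrictlyGE a] [E₀.IsStrictlyLE b]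
  (hK : ∀ p, IsFiniteLocallyFree (E₀.X p))
  {D : Type u'} [Category.{v'} D] [Preadditive D] [HasShift D ℤ]
  (Ψ : DerivedCategory X₀.left.Modules ⥤ D) [Ψ.Additive] [Ψ.CommShift ℤ]
  {W' : ℕ → Type*} [∀ q, AddCommGroup (W' q)]
  (σ' : ∀ q, (Ψ.obj (DerivedCategory.Q.obj E₀) ⟶ (Ψ.obj (DerivedCategory.Q.obj E₀))⟦(2 : ℤ)⟧) →+ W' q)

/-- **R1.0 kernel clause for a strictly perfect `E₀`, REAL source `σ_q`, minimal categorical input.** `E₀` a cochain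
complex of `𝒪_{X₀}`-modules concentrated in `[a, b]` with every term finite locally free (intended: a two-term locally
free representative of `Φ(I_p ⊠ I_q)`), `σ_q = HomComplex.sigmaC X₀ E₀ a b hK q` the tree's semiregularity components of a
complex; `Ψ : D(Mod 𝒪_{X₀}) ⥤ D` additive shift-commuting (intended `D(- ⊗ L^{∓1}) ∘ D(π^*)`) with
`θ x = Ψ x ≫ (Ψ.commShiftIso 2)_{E₀}` BIJECTIVE on `Hom(Q E₀, (Q E₀)⟦2⟧)` (the object-wise derived comparison at `E₀`);
`σ′_q` any additive components on `Hom(ΨE₀, (ΨE₀)⟦2⟧)` (intended those of `E₀′`; no gerbe carrier) which re-expand the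
`σ_q` through `θ` triangularly on a LOWER set `I` with injective diagonal `d_q` (intended `π^*` on `H^{q+2}(Ω^q)`;
`u` arbitrary). Then `E₀` is `I`-semiregular as a complex iff `(σ′_q)_{q ∈ I}` is jointly injective.
[cite: BuchweitzFlenner2003, Def. 4.1 and §5 (I-semiregular)] -/
theorem isISemiregularC_iff_jointlyInjective_of_bijective_commShift
    (hθ : Function.Bijective (fun x : DerivedCategory.Q.obj E₀ ⟶ (DerivedCategory.Q.obj E₀)⟦(2 : ℤ)⟧ =>
      Ψ.map x ≫ ((Ψ.commShiftIso (2 : ℤ)).app _).hom))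
    (d : ∀ q, ShiftedHom (DerivedCategory.Q.obj ((HomologicalComplex.single X₀.left.Modules (ComplexShape.up ℤ) 0).obj
        (unitModule X₀.left))) (DerivedCategory.Q.obj ((HomologicalComplex.single X₀.left.Modules (ComplexShape.up ℤ)
        0).obj (hodgeSheaf X₀ q))) ((q + 2 : ℕ) : ℤ) →+ W' q)
    (u : ∀ q j, ShiftedHom (DerivedCategory.Q.obj ((HomologicalComplex.single X₀.left.Modules (ComplexShape.up ℤ) 0).obj
        (unitModule X₀.left))) (DerivedCategory.Q.obj ((HomologicalComplex.single X₀.left.Modules (ComplexShape.up ℤ)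
        0).obj (hodgeSheaf X₀ j))) ((j + 2 : ℕ) : ℤ) →+ W' q)
    {I : Set ℕ} (hI : IsLowerSet I) (hd : ∀ q ∈ I, Function.Injective (d q))
    (hσ : ∀ q ∈ I, ∀ x : DerivedCategory.Q.obj E₀ ⟶ (DerivedCategory.Q.obj E₀)⟦(2 : ℤ)⟧,
      σ' q (Ψ.map x ≫ ((Ψ.commShiftIso (2 : ℤ)).app _).hom) =
        d q (HomComplex.sigmaC X₀ E₀ a b hK q x) + ∑ j ∈ Finset.range q, u q j (HomComplex.sigmaC X₀ E₀ a b hK j x)) :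
    HomComplex.IsISemiregularC X₀ E₀ a b hK I ↔
      ∀ x' : Ψ.obj (DerivedCategory.Q.obj E₀) ⟶ (Ψ.obj (DerivedCategory.Q.obj E₀))⟦(2 : ℤ)⟧,
        (∀ q ∈ I, σ' q x' = 0) → x' = 0 := by
  rw [HomComplex.isISemiregularC_iff_ker]
  exact jointlyInjective_iff_of_bijective_commShift Ψ (σ := fun q => HomComplex.sigmaCHom X₀ E₀ a b hK q) (σ' := σ')
    hθ d u hI hd hσ

end RealSourceMinimal

/-! ### 2. The consumed direction with `θ` from sheaf-level data (exact adjoint pair + equivalence) -/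

section RealSourceAdjunction

universe w w₂ w₃ v₂ v₃ u u₂ u₃

variable {S : Type u} [CommRing S] {X₀ : Over (Spec (CommRingCat.of S))}
  [HasDerivedCategory.{w} X₀.left.Modules]
  {C₂ : Type u₂} [Category.{v₂} C₂] [Abelian C₂] [HasDerivedCategory.{w₂} C₂]
  {C₃ : Type u₃} [Category.{v₃} C₃] [Abelian C₃] [HasDerivedCategory.{w₃} C₃]
  {F : X₀.left.Modules ⥤ C₂} {Rf : C₂ ⥤ X₀.left.Modules} [F.Additive] [Rf.Additive]
  [PreservesFiniteLimits F] [PreservesFiniteColimits F]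
  [PreservesFiniteLimits Rf] [PreservesFiniteColimits Rf] (adj : F ⊣ Rf) [F.Full] [F.Faithful]
  (Φe : C₂ ≌ C₃) [Φe.functor.Additive] [Φe.inverse.Additive]
  (E₀ : CochainComplex X₀.left.Modules ℤ) (a b : ℤ) [E₀.IsStrictlyGE a] [E₀.IsStrictlyLE b]
  (hK : ∀ p, IsFiniteLocallyFree (E₀.X p))
  {W' : ℕ → Type*} [∀ q, AddCommGroup (W' q)]
  (σ' : ∀ q, ((F.mapDerivedCategory ⋙ Φe.functor.mapDerivedCategory).obj (DerivedCategory.Q.obj E₀) ⟶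
    ((F.mapDerivedCategory ⋙ Φe.functor.mapDerivedCategory).obj (DerivedCategory.Q.obj E₀))⟦(2 : ℤ)⟧) →+ W' q)

include adj

/-- **FULL semiregularity of a strictly perfect `E₀` (the tree's `IsISemiregularC … univ`) is carried to the gerbe
side, `θ` REAL from sheaf-level data.** `F ⊣ Rf` an adjoint pair of EXACT functors out of `Mod(𝒪_{X₀})` with `F` full and
faithful (intended `π^* ⊣ π_*` for the tame `μ₂`-gerbe; `F` f.f. = the UNIT `E ⥲ π_*π^*E`), `Φe : C₂ ≌ C₃` an additive
equivalence (intended `- ⊗ L^{∓1}`), `Ψ = D(F) ⋙ D(Φe)`; `σ′_q` abstract components of `ΨE₀` re-expanding the REAL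
`σ_q = HomComplex.sigmaC X₀ E₀ a b hK q` through `θ x = Ψ x ≫ (Ψ.commShiftIso 2)_{E₀}` triangularly (`u` arbitrary) with
injective diagonals (intended `π^*`). Then: `E₀` fully semiregular as a complex ⟹ all `σ′_q` jointly injective on
`Hom(ΨE₀, (ΨE₀)⟦2⟧)`. [cite: BuchweitzFlenner2003, Def. 4.1 and §5; GortzWedhorn2023, Prop. F.191; Lieblich2007, arXiv
Lemma 2.1.1.12] -/
theorem jointlyInjective_of_isISemiregularC_univ_of_exactAdjunction_equivalence
    (d : ∀ q, ShiftedHom (DerivedCategory.Q.obj ((HomologicalComplex.single X₀.left.Modules (ComplexShape.up ℤ) 0).obj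
        (unitModule X₀.left))) (DerivedCategory.Q.obj ((HomologicalComplex.single X₀.left.Modules (ComplexShape.up ℤ)
        0).obj (hodgeSheaf X₀ q))) ((q + 2 : ℕ) : ℤ) →+ W' q)
    (u : ∀ q j, ShiftedHom (DerivedCategory.Q.obj ((HomologicalComplex.single X₀.left.Modules (ComplexShape.up ℤ) 0).obj
        (unitModule X₀.left))) (DerivedCategory.Q.obj ((HomologicalComplex.single X₀.left.Modules (ComplexShape.up ℤ)
        0).obj (hodgeSheaf X₀ j))) ((j + 2 : ℕ) : ℤ) →+ W' q)
    (hd : ∀ q, Function.Injective (d q))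
    (hσ : ∀ (q : ℕ) (x : DerivedCategory.Q.obj E₀ ⟶ (DerivedCategory.Q.obj E₀)⟦(2 : ℤ)⟧),
      σ' q ((F.mapDerivedCategory ⋙ Φe.functor.mapDerivedCategory).map x ≫
        (((F.mapDerivedCategory ⋙ Φe.functor.mapDerivedCategory).commShiftIso (2 : ℤ)).app _).hom) =
        d q (HomComplex.sigmaC X₀ E₀ a b hK q x) + ∑ j ∈ Finset.range q, u q j (HomComplex.sigmaC X₀ E₀ a b hK j x))
    (h : HomComplex.IsISemiregularC X₀ E₀ a b hK Set.univ)
    (x' : (F.mapDerivedCategory ⋙ Φe.functor.mapDerivedCategory).obj (DerivedCategory.Q.obj E₀) ⟶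
      ((F.mapDerivedCategory ⋙ Φe.functor.mapDerivedCategory).obj (DerivedCategory.Q.obj E₀))⟦(2 : ℤ)⟧)
    (hx' : ∀ q, σ' q x' = 0) : x' = 0 :=
  jointlyInjective_univ_complex_of_exactAdjunction_equivalence adj Φe E₀
    (σ := fun q => HomComplex.sigmaCHom X₀ E₀ a b hK q) (σ' := σ') d u hd hσ
    (fun x hx => (HomComplex.isISemiregularC_iff_ker X₀ E₀ a b hK Set.univ).1 h x fun q _ => hx q) x' hx'

end RealSourceAdjunction

/-! ### 3. The same two statements with the mixing maps produced by the Leibniz rule -/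

section RealSourceLeibnizMinimal

universe w v' u u'

variable {S : Type u} [CommRing S] {X₀ : Over (Spec (CommRingCat.of S))} [HasDerivedCategory.{w} X₀.left.Modules]
  (E₀ : CochainComplex X₀.left.Modules ℤ) (a b : ℤ) [E₀.IsStrictlyGE a] [E₀.IsStrictlyLE b]
  (hK : ∀ p, IsFiniteLocallyFree (E₀.X p))
  {D : Type u'} [Category.{v'} D] [Preadditive D] [HasShift D ℤ]
  (Ψ : DerivedCategory X₀.left.Modules ⥤ D) [Ψ.Additive] [Ψ.CommShift ℤ]
  {W' : ℕ → Type*} [∀ q, AddCommGroup (W' q)]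
  (σ' : ∀ q, (Ψ.obj (DerivedCategory.Q.obj E₀) ⟶ (Ψ.obj (DerivedCategory.Q.obj E₀))⟦(2 : ℤ)⟧) →+ W' q)
  {R R' : Type*} [Ring R] [Ring R']

/-- **Kernel clause, REAL source `σ_q`, Leibniz data.** As `isISemiregularC_iff_jointlyInjective_of_bijective_commShift`, the
triangular re-expansion now DERIVED from Buchweitz–Flenner algebra data: `θ_R : R →+* R′`, Leibniz rule `a′ = θ_R a + c`
[Atiyah 1957 Prop. 10–12; HL §10.1.5], `Commute (θ_R a) c` (interchange law), trace compatibilities `hd`, `hμ`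
[BF §4.1], realising `σ_q = HomComplex.sigmaC` as `τ_q(ι x · a^q)`, `σ′_q` as `τ′_q(ι′ x′ · a′^q)`, and `θ` by
`ι′(θ x) = θ_R(ι x)` (binders: the ring `A_{E₀}` is not a real carrier); `θ` bijective at `E₀`; `d_q` injective on the
lower set `I`. Then `IsISemiregularC X₀ E₀ a b hK I ↔ (σ′_q)_{q ∈ I}` jointly injective.
[cite: BuchweitzFlenner2003, Def. 4.1 and §5; Atiyah1957, Prop. 10–12] -/
theorem isISemiregularC_iff_jointlyInjective_of_bijective_commShift_of_leibniz
    (hθ : Function.Bijective (fun x : DerivedCategory.Q.obj E₀ ⟶ (DerivedCategory.Q.obj E₀)⟦(2 : ℤ)⟧ =>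
      Ψ.map x ≫ ((Ψ.commShiftIso (2 : ℤ)).app _).hom))
    (θ : R →+* R') {a₀ : R} {a' c : R'} (ha' : a' = θ a₀ + c) (hc : Commute (θ a₀) c)
    (τ : ∀ q, R →+ ShiftedHom (DerivedCategory.Q.obj ((HomologicalComplex.single X₀.left.Modules (ComplexShape.up ℤ)
        0).obj (unitModule X₀.left))) (DerivedCategory.Q.obj ((HomologicalComplex.single X₀.left.Modules
        (ComplexShape.up ℤ) 0).obj (hodgeSheaf X₀ q))) ((q + 2 : ℕ) : ℤ))
    (τ' : ∀ q, R' →+ W' q)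
    (d : ∀ q, ShiftedHom (DerivedCategory.Q.obj ((HomologicalComplex.single X₀.left.Modules (ComplexShape.up ℤ) 0).obj
        (unitModule X₀.left))) (DerivedCategory.Q.obj ((HomologicalComplex.single X₀.left.Modules (ComplexShape.up ℤ)
        0).obj (hodgeSheaf X₀ q))) ((q + 2 : ℕ) : ℤ) →+ W' q)
    (hd : ∀ (q : ℕ) (y : R), τ' q (θ y) = d q (τ q y))
    (μ : ∀ q j, W' j →+ W' q)
    (hμ : ∀ (q j : ℕ) (y : R'), j ≤ q → τ' q (y * c ^ (q - j)) = μ q j (τ' j y))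
    (ι : (DerivedCategory.Q.obj E₀ ⟶ (DerivedCategory.Q.obj E₀)⟦(2 : ℤ)⟧) →+ R)
    (ι' : (Ψ.obj (DerivedCategory.Q.obj E₀) ⟶ (Ψ.obj (DerivedCategory.Q.obj E₀))⟦(2 : ℤ)⟧) →+ R')
    (hθ₀ : ∀ x : DerivedCategory.Q.obj E₀ ⟶ (DerivedCategory.Q.obj E₀)⟦(2 : ℤ)⟧,
      ι' (Ψ.map x ≫ ((Ψ.commShiftIso (2 : ℤ)).app _).hom) = θ (ι x))
    (hσ : ∀ (q : ℕ) (x : DerivedCategory.Q.obj E₀ ⟶ (DerivedCategory.Q.obj E₀)⟦(2 : ℤ)⟧),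
      HomComplex.sigmaC X₀ E₀ a b hK q x = τ q (ι x * a₀ ^ q))
    (hσ' : ∀ (q : ℕ) (x' : Ψ.obj (DerivedCategory.Q.obj E₀) ⟶ (Ψ.obj (DerivedCategory.Q.obj E₀))⟦(2 : ℤ)⟧),
      σ' q x' = τ' q (ι' x' * a' ^ q))
    {I : Set ℕ} (hI : IsLowerSet I) (hdI : ∀ q ∈ I, Function.Injective (d q)) :
    HomComplex.IsISemiregularC X₀ E₀ a b hK I ↔
      ∀ x' : Ψ.obj (DerivedCategory.Q.obj E₀) ⟶ (Ψ.obj (DerivedCategory.Q.obj E₀))⟦(2 : ℤ)⟧,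
        (∀ q ∈ I, σ' q x' = 0) → x' = 0 := by
  let θ₀ : (DerivedCategory.Q.obj E₀ ⟶ (DerivedCategory.Q.obj E₀)⟦(2 : ℤ)⟧) →+
      (Ψ.obj (DerivedCategory.Q.obj E₀) ⟶ (Ψ.obj (DerivedCategory.Q.obj E₀))⟦(2 : ℤ)⟧) :=
    AddMonoidHom.mk' (fun x => Ψ.map x ≫ ((Ψ.commShiftIso (2 : ℤ)).app _).hom) fun x y => by
      change Ψ.map (x + y) ≫ _ = Ψ.map x ≫ _ + Ψ.map y ≫ _
      rw [Ψ.map_add]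
      exact Preadditive.add_comp _ _ _ _ _ _
  exact isISemiregularC_iff_jointlyInjective_of_bijective_commShift E₀ a b hK Ψ σ' hθ d
    (fun q j => (μ q j).comp ((d j).comp (DistribSMul.toAddMonoidHom _ (q.choose j)))) hI hdI
    fun q _ x => sigma_leibniz_triangular (σ := fun q => HomComplex.sigmaCHom X₀ E₀ a b hK q) (σ' := σ') θ ha' hc
      τ τ' d hd μ hμ ι ι' θ₀ hθ₀ hσ hσ' q x

end RealSourceLeibnizMinimal

section RealSourceLeibnizAdjunction

universe w w₂ w₃ v₂ v₃ u u₂ u₃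

variable {S : Type u} [CommRing S] {X₀ : Over (Spec (CommRingCat.of S))}
  [HasDerivedCategory.{w} X₀.left.Modules]
  {C₂ : Type u₂} [Category.{v₂} C₂] [Abelian C₂] [HasDerivedCategory.{w₂} C₂]
  {C₃ : Type u₃} [Category.{v₃} C₃] [Abelian C₃] [HasDerivedCategory.{w₃} C₃]
  {F : X₀.left.Modules ⥤ C₂} {Rf : C₂ ⥤ X₀.left.Modules} [F.Additive] [Rf.Additive]
  [PreservesFiniteLimits F] [PreservesFiniteColimits F]
  [PreservesFiniteLimits Rf] [PreservesFiniteColimits Rf] (adj : F ⊣ Rf) [F.Full] [F.Faithful]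
  (Φe : C₂ ≌ C₃) [Φe.functor.Additive] [Φe.inverse.Additive]
  (E₀ : CochainComplex X₀.left.Modules ℤ) (a b : ℤ) [E₀.IsStrictlyGE a] [E₀.IsStrictlyLE b]
  (hK : ∀ p, IsFiniteLocallyFree (E₀.X p))
  {W' : ℕ → Type*} [∀ q, AddCommGroup (W' q)]
  (σ' : ∀ q, ((F.mapDerivedCategory ⋙ Φe.functor.mapDerivedCategory).obj (DerivedCategory.Q.obj E₀) ⟶
    ((F.mapDerivedCategory ⋙ Φe.functor.mapDerivedCategory).obj (DerivedCategory.Q.obj E₀))⟦(2 : ℤ)⟧) →+ W' q)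
  {R R' : Type*} [Ring R] [Ring R']

include adj

/-- **R1.0 for a strictly perfect `E₀`, fully assembled: tree predicate in, joint injectivity out.** `F ⊣ Rf` exact
adjoint pair out of `Mod(𝒪_{X₀})` with `F` full faithful (intended `π^* ⊣ π_*`, tame; unit iso), `Φe` an additive
equivalence (intended `- ⊗ L^{∓1}`), `Ψ = D(F) ⋙ D(Φe)`; Buchweitz–Flenner algebra data with the Leibniz rule
`a′ = θ_R a + c`, `Commute (θ_R a) c` and the trace compatibilities, realising the REAL `σ_q = HomComplex.sigmaC`, the
abstract `σ′_q` and `θ`; `d_q` injective (intended `π^*` on `H^{q+2}(Ω^q)`). THEN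
`HomComplex.IsISemiregularC X₀ E₀ a b hK univ` (FULL `σ_{E₀}` injective, the tree's predicate) ⟹ all `σ′_q` jointly
injective on `Hom(ΨE₀, (ΨE₀)⟦2⟧)` (FULL `σ_{E₀′}` injective). [cite: BuchweitzFlenner2003, Def. 4.1 and §5; Atiyah1957,
Prop. 10–12; GortzWedhorn2023, Prop. F.191; Lieblich2007, arXiv Lemma 2.1.1.12] -/
theorem jointlyInjective_of_isISemiregularC_univ_of_exactAdjunction_equivalence_of_leibniz
    (θ : R →+* R') {a₀ : R} {a' c : R'} (ha' : a' = θ a₀ + c) (hc : Commute (θ a₀) c)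
    (τ : ∀ q, R →+ ShiftedHom (DerivedCategory.Q.obj ((HomologicalComplex.single X₀.left.Modules (ComplexShape.up ℤ)
        0).obj (unitModule X₀.left))) (DerivedCategory.Q.obj ((HomologicalComplex.single X₀.left.Modules
        (ComplexShape.up ℤ) 0).obj (hodgeSheaf X₀ q))) ((q + 2 : ℕ) : ℤ))
    (τ' : ∀ q, R' →+ W' q)
    (d : ∀ q, ShiftedHom (DerivedCategory.Q.obj ((HomologicalComplex.single X₀.left.Modules (ComplexShape.up ℤ) 0).obj
        (unitModule X₀.left))) (DerivedCategory.Q.obj ((HomologicalComplex.single X₀.left.Modules (ComplexShape.up ℤ)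
        0).obj (hodgeSheaf X₀ q))) ((q + 2 : ℕ) : ℤ) →+ W' q)
    (hd : ∀ (q : ℕ) (y : R), τ' q (θ y) = d q (τ q y))
    (μ : ∀ q j, W' j →+ W' q)
    (hμ : ∀ (q j : ℕ) (y : R'), j ≤ q → τ' q (y * c ^ (q - j)) = μ q j (τ' j y))
    (ι : (DerivedCategory.Q.obj E₀ ⟶ (DerivedCategory.Q.obj E₀)⟦(2 : ℤ)⟧) →+ R)
    (ι' : (((F.mapDerivedCategory ⋙ Φe.functor.mapDerivedCategory).obj (DerivedCategory.Q.obj E₀) ⟶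
      ((F.mapDerivedCategory ⋙ Φe.functor.mapDerivedCategory).obj (DerivedCategory.Q.obj E₀))⟦(2 : ℤ)⟧)) →+ R')
    (hθ₀ : ∀ x : DerivedCategory.Q.obj E₀ ⟶ (DerivedCategory.Q.obj E₀)⟦(2 : ℤ)⟧,
      ι' ((F.mapDerivedCategory ⋙ Φe.functor.mapDerivedCategory).map x ≫
        (((F.mapDerivedCategory ⋙ Φe.functor.mapDerivedCategory).commShiftIso (2 : ℤ)).app _).hom) = θ (ι x))
    (hσ : ∀ (q : ℕ) (x : DerivedCategory.Q.obj E₀ ⟶ (DerivedCategory.Q.obj E₀)⟦(2 : ℤ)⟧),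
      HomComplex.sigmaC X₀ E₀ a b hK q x = τ q (ι x * a₀ ^ q))
    (hσ' : ∀ (q : ℕ) (x' : (F.mapDerivedCategory ⋙ Φe.functor.mapDerivedCategory).obj (DerivedCategory.Q.obj E₀) ⟶
      ((F.mapDerivedCategory ⋙ Φe.functor.mapDerivedCategory).obj (DerivedCategory.Q.obj E₀))⟦(2 : ℤ)⟧),
      σ' q x' = τ' q (ι' x' * a' ^ q))
    (hdI : ∀ q, Function.Injective (d q)) (h : HomComplex.IsISemiregularC X₀ E₀ a b hK Set.univ)
    (x' : (F.mapDerivedCategory ⋙ Φe.functor.mapDerivedCategory).obj (DerivedCategory.Q.obj E₀) ⟶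
      ((F.mapDerivedCategory ⋙ Φe.functor.mapDerivedCategory).obj (DerivedCategory.Q.obj E₀))⟦(2 : ℤ)⟧)
    (hx' : ∀ q, σ' q x' = 0) : x' = 0 :=
  jointlyInjective_univ_complex_of_exactAdjunction_equivalence_of_leibniz adj Φe E₀
    (σ := fun q => HomComplex.sigmaCHom X₀ E₀ a b hK q) (σ' := σ') θ ha' hc τ τ' d hd μ hμ ι ι' hθ₀ hσ hσ' hdI
    (fun x hx => (HomComplex.isISemiregularC_iff_ker X₀ E₀ a b hK Set.univ).1 h x fun q _ => hx q) x' hx'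

end RealSourceLeibnizAdjunction

/-! ### 4. Untwisted reading, BOTH sides real: two strictly perfect complexes on the same `X₀`
(`E₀′ = E₀ ⊗ M_B`), `θ` any additive bijection, the tree's `IsISemiregularC` on both sides -/

section SameSchemeReal

universe w u

variable {S : Type u} [CommRing S] {X₀ : Over (Spec (CommRingCat.of S))} [HasDerivedCategory.{w} X₀.left.Modules]
  (E₀ E₀' : CochainComplex X₀.left.Modules ℤ) (a b a' b' : ℤ) [E₀.IsStrictlyGE a] [E₀.IsStrictlyLE b]
  [E₀'.IsStrictlyGE a'] [E₀'.IsStrictlyLE b']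
  (hK : ∀ p, IsFiniteLocallyFree (E₀.X p)) (hK' : ∀ p, IsFiniteLocallyFree (E₀'.X p))
  {R R' : Type*} [Ring R] [Ring R']

/-- **R1.0 in the untwisted reading with BOTH sides the tree's real predicate.** `E₀`, `E₀′` strictly perfect complexes
on the SAME `X₀/S` (intended `E₀ = Φ(I_p ⊠ I_q)` and `E₀′ = E₀ ⊗ M_B`, both two-term locally free), `θ` ANY additive
bijection `Hom(Q E₀, (Q E₀)⟦2⟧) ≃ Hom(Q E₀′, (Q E₀′)⟦2⟧)` (intended: induced by `D(- ⊗ M_B)` and `E₀ ⊗ M_B ≅ E₀′`; which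
`θ` exist is not asserted), and the REAL components `HomComplex.sigmaC` of `E₀′` re-expand those of `E₀` through `θ`
triangularly on a LOWER set `I` with injective diagonal `d_q` (intended `id`; `u` arbitrary — the Leibniz rule). Then
`IsISemiregularC X₀ E₀ a b hK I ↔ IsISemiregularC X₀ E₀′ a′ b′ hK′ I`. [cite: BuchweitzFlenner2003, Def. 4.1 and §5] -/
theorem isISemiregularC_iff_isISemiregularC_of_triangular
    (θ : (DerivedCategory.Q.obj E₀ ⟶ (DerivedCategory.Q.obj E₀)⟦(2 : ℤ)⟧) ≃+
      (DerivedCategory.Q.obj E₀' ⟶ (DerivedCategory.Q.obj E₀')⟦(2 : ℤ)⟧))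
    (d : ∀ q, ShiftedHom (DerivedCategory.Q.obj ((HomologicalComplex.single X₀.left.Modules (ComplexShape.up ℤ) 0).obj
        (unitModule X₀.left))) (DerivedCategory.Q.obj ((HomologicalComplex.single X₀.left.Modules (ComplexShape.up ℤ)
        0).obj (hodgeSheaf X₀ q))) ((q + 2 : ℕ) : ℤ) →+
      ShiftedHom (DerivedCategory.Q.obj ((HomologicalComplex.single X₀.left.Modules (ComplexShape.up ℤ) 0).obj
        (unitModule X₀.left))) (DerivedCategory.Q.obj ((HomologicalComplex.single X₀.left.Modules (ComplexShape.up ℤ)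
        0).obj (hodgeSheaf X₀ q))) ((q + 2 : ℕ) : ℤ))
    (u : ∀ q j, ShiftedHom (DerivedCategory.Q.obj ((HomologicalComplex.single X₀.left.Modules (ComplexShape.up ℤ) 0).obj
        (unitModule X₀.left))) (DerivedCategory.Q.obj ((HomologicalComplex.single X₀.left.Modules (ComplexShape.up ℤ)
        0).obj (hodgeSheaf X₀ j))) ((j + 2 : ℕ) : ℤ) →+
      ShiftedHom (DerivedCategory.Q.obj ((HomologicalComplex.single X₀.left.Modules (ComplexShape.up ℤ) 0).obj
        (unitModule X₀.left))) (DerivedCategory.Q.obj ((HomologicalComplex.single X₀.left.Modules (ComplexShape.up ℤ)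
        0).obj (hodgeSheaf X₀ q))) ((q + 2 : ℕ) : ℤ))
    {I : Set ℕ} (hI : IsLowerSet I) (hd : ∀ q ∈ I, Function.Injective (d q))
    (hσ : ∀ q ∈ I, ∀ x : DerivedCategory.Q.obj E₀ ⟶ (DerivedCategory.Q.obj E₀)⟦(2 : ℤ)⟧,
      HomComplex.sigmaC X₀ E₀' a' b' hK' q (θ x) =
        d q (HomComplex.sigmaC X₀ E₀ a b hK q x) + ∑ j ∈ Finset.range q, u q j (HomComplex.sigmaC X₀ E₀ a b hK j x)) :
    HomComplex.IsISemiregularC X₀ E₀ a b hK I ↔ HomComplex.IsISemiregularC X₀ E₀' a' b' hK' I := by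
  rw [HomComplex.isISemiregularC_iff_ker, HomComplex.isISemiregularC_iff_ker]
  exact jointlyInjective_iff_of_triangular (σ := fun q => HomComplex.sigmaCHom X₀ E₀ a b hK q)
    (σ' := fun q => HomComplex.sigmaCHom X₀ E₀' a' b' hK' q) θ d u hI hd hσ

/-- **The same with the mixing maps from the Leibniz rule** (`UntwistSigmaMultiplier`): Buchweitz–Flenner algebra data
`θ_R : R →+* R′` (intended the identification `A_{E₀ ⊗ M} = A_{E₀}`), `a′ = θ_R a + c` with `c = 1 ⊗ At(M_B)`,
`Commute (θ_R a) c`, trace compatibilities, realising the two REAL families `HomComplex.sigmaC` of `E₀`, `E₀′` and the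
bijection `θ`; `d_q` injective on the lower set `I` (intended `id`: same `X₀`, `rk M_B = 1`). Then
`IsISemiregularC X₀ E₀ a b hK I ↔ IsISemiregularC X₀ E₀′ a′ b′ hK′ I` — FULL semiregularity for `I = univ`.
[cite: BuchweitzFlenner2003, Def. 4.1 and §5; Atiyah1957, Prop. 10–12] -/
theorem isISemiregularC_iff_isISemiregularC_of_leibniz
    (θ₀ : (DerivedCategory.Q.obj E₀ ⟶ (DerivedCategory.Q.obj E₀)⟦(2 : ℤ)⟧) ≃+
      (DerivedCategory.Q.obj E₀' ⟶ (DerivedCategory.Q.obj E₀')⟦(2 : ℤ)⟧))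
    (θ : R →+* R') {a₀ : R} {a₀' c : R'} (ha' : a₀' = θ a₀ + c) (hc : Commute (θ a₀) c)
    (τ : ∀ q, R →+ ShiftedHom (DerivedCategory.Q.obj ((HomologicalComplex.single X₀.left.Modules (ComplexShape.up ℤ)
        0).obj (unitModule X₀.left))) (DerivedCategory.Q.obj ((HomologicalComplex.single X₀.left.Modules
        (ComplexShape.up ℤ) 0).obj (hodgeSheaf X₀ q))) ((q + 2 : ℕ) : ℤ))
    (τ' : ∀ q, R' →+ ShiftedHom (DerivedCategory.Q.obj ((HomologicalComplex.single X₀.left.Modules (ComplexShape.up ℤ)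
        0).obj (unitModule X₀.left))) (DerivedCategory.Q.obj ((HomologicalComplex.single X₀.left.Modules
        (ComplexShape.up ℤ) 0).obj (hodgeSheaf X₀ q))) ((q + 2 : ℕ) : ℤ))
    (d : ∀ q, ShiftedHom (DerivedCategory.Q.obj ((HomologicalComplex.single X₀.left.Modules (ComplexShape.up ℤ) 0).obj
        (unitModule X₀.left))) (DerivedCategory.Q.obj ((HomologicalComplex.single X₀.left.Modules (ComplexShape.up ℤ)
        0).obj (hodgeSheaf X₀ q))) ((q + 2 : ℕ) : ℤ) →+
      ShiftedHom (DerivedCategory.Q.obj ((HomologicalComplex.single X₀.left.Modules (ComplexShape.up ℤ) 0).obj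
        (unitModule X₀.left))) (DerivedCategory.Q.obj ((HomologicalComplex.single X₀.left.Modules (ComplexShape.up ℤ)
        0).obj (hodgeSheaf X₀ q))) ((q + 2 : ℕ) : ℤ))
    (hd : ∀ (q : ℕ) (y : R), τ' q (θ y) = d q (τ q y))
    (μ : ∀ q j, ShiftedHom (DerivedCategory.Q.obj ((HomologicalComplex.single X₀.left.Modules (ComplexShape.up ℤ) 0).obj
        (unitModule X₀.left))) (DerivedCategory.Q.obj ((HomologicalComplex.single X₀.left.Modules (ComplexShape.up ℤ)
        0).obj (hodgeSheaf X₀ j))) ((j + 2 : ℕ) : ℤ) →+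
      ShiftedHom (DerivedCategory.Q.obj ((HomologicalComplex.single X₀.left.Modules (ComplexShape.up ℤ) 0).obj
        (unitModule X₀.left))) (DerivedCategory.Q.obj ((HomologicalComplex.single X₀.left.Modules (ComplexShape.up ℤ)
        0).obj (hodgeSheaf X₀ q))) ((q + 2 : ℕ) : ℤ))
    (hμ : ∀ (q j : ℕ) (y : R'), j ≤ q → τ' q (y * c ^ (q - j)) = μ q j (τ' j y))
    (ι : (DerivedCategory.Q.obj E₀ ⟶ (DerivedCategory.Q.obj E₀)⟦(2 : ℤ)⟧) →+ R)
    (ι' : (DerivedCategory.Q.obj E₀' ⟶ (DerivedCategory.Q.obj E₀')⟦(2 : ℤ)⟧) →+ R')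
    (hθ₀ : ∀ x, ι' (θ₀ x) = θ (ι x))
    (hσ : ∀ (q : ℕ) (x : DerivedCategory.Q.obj E₀ ⟶ (DerivedCategory.Q.obj E₀)⟦(2 : ℤ)⟧),
      HomComplex.sigmaC X₀ E₀ a b hK q x = τ q (ι x * a₀ ^ q))
    (hσ' : ∀ (q : ℕ) (x' : DerivedCategory.Q.obj E₀' ⟶ (DerivedCategory.Q.obj E₀')⟦(2 : ℤ)⟧),
      HomComplex.sigmaC X₀ E₀' a' b' hK' q x' = τ' q (ι' x' * a₀' ^ q))
    {I : Set ℕ} (hI : IsLowerSet I) (hdI : ∀ q ∈ I, Function.Injective (d q)) :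
    HomComplex.IsISemiregularC X₀ E₀ a b hK I ↔ HomComplex.IsISemiregularC X₀ E₀' a' b' hK' I :=
  isISemiregularC_iff_isISemiregularC_of_triangular E₀ E₀' a b a' b' hK hK' θ₀ d
    (fun q j => (μ q j).comp ((d j).comp (DistribSMul.toAddMonoidHom _ (q.choose j)))) hI hdI
    fun q _ x => sigma_leibniz_triangular (σ := fun q => HomComplex.sigmaCHom X₀ E₀ a b hK q)
      (σ' := fun q => HomComplex.sigmaCHom X₀ E₀' a' b' hK' q) θ ha' hc τ τ' d hd μ hμ ι ι' θ₀.toAddMonoidHom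
      (fun x => hθ₀ x) hσ hσ' q x

end SameSchemeReal

end Summit.Ventures.HSemireg
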